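import Literature.NumberTheory.EllipticCurves.CastellaGrossiSkinner2025.TwoLineEulerCharacteristic
import Literature.NumberTheory.EllipticCurves.CastellaGrossiSkinner2025.MazurMainConjectureRankOne
import Literature.NumberTheory.EllipticCurves.CastellaGrossiLeeSkinner2022.AnticyclotomicControlTorsionFree
import Literature.NumberTheory.EllipticCurves.ZpExtensionAnticyclotomicHoldsProofs
import Literature.NumberTheory.EllipticCurves.SelmerCorankHolds
import HarnessLib

/-!
# Crux `MazurMCOnX1RankZero` (item stmt-BirchSwinnertonDyer-19035), line `interlude_with_torsion`:
# the TWO-LINE TRANSPORT OF A VALUE at a `K`-torsion-free member — from the anticyclotomic to the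
# cyclotomic Greenberg characteristic series (print-fed: [CGLS22] Thm. 5.1.1 as proved + [CGS25] Prop. 3.4.2)

Cell `bsd-eis` (host `run/shared/lean/pub/bsd-eis/`), lead `bsd-line-x1-p2` (g3); `--supports`
stmt-BirchSwinnertonDyer-19035 as a HELPER (no registered stub: it serves the line's print-maximal
re-route recorded in `Cruxes/MazurMCOnX1RankZero/Lines/interlude_with_torsion-REPORT.md` §3). No summit
statement (BSD, Mazur's main conjecture, IMC2) is proved here. Route-independent imports (no `Theses`
module in the cone).

WHAT. For ANY member `W` of an isogeny class with `W(K)[p] = 0` (good ordinary odd `p`, Heegner `K`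
with `p` split, `rank W(K) = 1`, `Ш(W/K)[p^∞]` finite, the cyclotomic pair `(κ, γ)`), and ANY `p`-adic
number `X`: IF for every anticyclotomic pair `(κ₋, γ₋)` the characteristic ideal of
`X_Gr(W/K_∞⁻) = AcSelmer.XAc (W.baseChange K) p κ₋ vbar ∅ γ₋` has a generator `𝓕` with `𝓕(0) = u·X`
(`u ∈ ℤ_p^×`) — the shape in which crux 2 (Keller–Yin IMC2 ∘ BDP) and its lattice transport
(Kobayashi–Ota Prop. 2.9, `KobayashiOta2020.prop29_…`) deliver the BDP value — THEN `X_Gr(W/K_∞⁺)` is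
torsion with a generator `𝓕⁺`, `𝓕⁺(0) ≠ 0`, `𝓕⁺(0) = u'·X`. Proof: [CGLS] Thm. 5.1.1 (as proved, typed
`thm511_anticyclotomicControl_of_torsionFree`) gives SOME generator with non-zero constant term on the
`−` line, hence every generator has the same (non-zero) valuation; [CGS25] Prop. 3.4.2 at `α = 𝟙`
(typed `CastellaGrossiSkinner2025.prop342_twoLineEulerChar_trivialChar`, p615412) transports the valuation
to the `+` line; two non-zero `p`-adic integers of equal valuation differ by a unit. This is the
abstract-value form of the landed `cycLineBDPValue_of_localTransport` (p614823), with (K1) fed by PRINT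
and the value decoupled from crux 2 — so that it applies at Wüthrich's lattice `E_•` whenever
`E_•(K)[p] = 0` (the line's sub-row T0). [cite: CastellaGrossiSkinner2025, Prop. 3.4.2 with Lemma 3.4.1, §5 Steps 1 and 3]
[cite: CastellaGrossiLeeSkinner2022, Thm. 5.1.1 and its proof]
-/

set_option linter.dupNamespace false
set_option autoImplicit false

noncomputable section

open scoped Classical

open WeierstrassCurve NumberField IsDedekindDomain Field
  Literature.NumberTheory.EllipticCurves Literature.NumberTheory.EllipticCurves.Rank1Residual
  Literature.NumberTheory.EllipticCurves.Castella2018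

namespace Summit.BirchSwinnertonDyer.BirchSwinnertonDyer.Theorems.InterludeWithTorsion

/-- **Two-line transport of a value at a `K`-torsion-free member.** For `W` with good ordinary
reduction at the odd prime `p`, `K` imaginary quadratic with (Heeg) for `N_W` and `p` split,
`W(K)[p] = 0`, `rank W(K) = 1`, `Ш(W/K)[p^∞]` finite, an embedding `ι : K → ℚ_p` cutting out `v`,
`vbar ∋ p` the other prime, the cyclotomic pair `(κ, γ)` and a `p`-adic number `X`: if on EVERY
anticyclotomic line `(κ₋, γ₋)` the characteristic ideal of `X_Gr(W/K_∞⁻)` is principal with a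
generator whose constant term is a unit multiple of `X`, then `X_Gr(W/K_∞⁺)` is `Λ`-torsion with a
generator `𝓕⁺`, `𝓕⁺(0) ≠ 0` and `𝓕⁺(0) = u'·X` for some `u' ∈ ℤ_p^×`. CONDITIONAL on the two refereed
named facts `h511` ([CGLS] Thm. 5.1.1 as proved) and `h342` ([CGS25] Prop. 3.4.2 at `α = 𝟙`).
[cite: CastellaGrossiSkinner2025, Prop. 3.4.2 with Lemma 3.4.1] [cite: CastellaGrossiLeeSkinner2022, Thm. 5.1.1 and its proof] -/
theorem plusLineValue_of_minusLineValue
    (h511 : CastellaGrossiLeeSkinner2022.thm511_anticyclotomicControl_of_torsionFree)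
    (h342 : CastellaGrossiSkinner2025.prop342_twoLineEulerChar_trivialChar) :
    ∀ (W : WeierstrassCurve ℚ) [W.IsElliptic] [W.IsGloballyMinimal] (p : ℕ) [Fact p.Prime],
      2 < p → GoodOrd W p →
      ∀ (K : Type) [Field K] [NumberField K], IsImaginaryQuadratic K →
        SatisfiesHeegnerHypothesis (W.conductorNorm ℤ) K → SatisfiesHeegnerHypothesis p K →
        (∀ Q : (W.baseChange K).toAffine.Point, p • Q = 0 → Q = 0) →
        (W.baseChange K).mordellWeilRank = 1 →
        Finite (AddCommGroup.primaryComponent (W.baseChange K).sha p) →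
      ∀ (ι : K →+* ℚ_[p]) (v vbar : HeightOneSpectrum (𝓞 K)),
        (∀ x : 𝓞 K, x ∈ v.asIdeal ↔ ‖ι (x : K)‖ < 1) →
        ((p : ℕ) : 𝓞 K) ∈ vbar.asIdeal → vbar ≠ v →
      ∀ (κ : ZpExtension K p), κ.IsCyclotomic →
      ∀ (γ : absoluteGaloisGroup K) [Fact (κ.IsTopGenerator γ)],
      ∀ (X : ℚ_[p]),
        (∀ (κm : ZpExtension K p), κm.IsAnticyclotomic →
          ∀ (γm : absoluteGaloisGroup K) [Fact (κm.IsTopGenerator γm)],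
            ∃ F : IwasawaAlgebra p,
              AcSelmer.XAc.charIdeal (W.baseChange K) p κm vbar ∅ γm = Ideal.span {F} ∧
              ∃ u : ℤ_[p]ˣ, ((PowerSeries.constantCoeff F : ℤ_[p]) : ℚ_[p]) = ((u : ℤ_[p]) : ℚ_[p]) * X) →
        Module.IsTorsion (IwasawaAlgebra p) (AcSelmer.XAc (W.baseChange K) p κ vbar ∅ γ) ∧
        ∃ F : IwasawaAlgebra p,
          AcSelmer.XAc.charIdeal (W.baseChange K) p κ vbar ∅ γ = Ideal.span {F} ∧
          PowerSeries.constantCoeff F ≠ 0 ∧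
          ∃ u : ℤ_[p]ˣ, ((PowerSeries.constantCoeff F : ℤ_[p]) : ℚ_[p]) = ((u : ℤ_[p]) : ℚ_[p]) * X := by
  intro W _ _ p _ hp hord K _ _ hK hHN hHp hEK hrank hfin ι v vbar hv hvbar hne κ hκ γ _ X hminus
  -- (Sel) and a point of infinite order, from rank 1 and finite `Ш[p^∞]` (corank identity)
  obtain ⟨hSel, P₀, hP₀⟩ :=
    CastellaGrossiSkinner2025.selmerCorank_eq_one_and_exists_not_isOfFinAddOrder W p
      ((W.baseChange K).selmerCorank_eq_mordellWeilRank_add_holds) hrank hfin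
  -- an anticyclotomic `ℤ_p`-extension of `K` with a topological generator
  haveI : NumberField.IsTotallyComplex K := hK.2
  obtain ⟨κm, hκm⟩ := ZpExtension.exists_isAnticyclotomic_holds (K := K) (p := p) hK.1
    (fun w ↦ NumberField.IsTotallyComplex.isComplex w)
  obtain ⟨γm, hγm⟩ := κm.surjective (Multiplicative.ofAdd 1)
  haveI : Fact (κm.IsTopGenerator γm) := ⟨hγm⟩
  -- [CGLS] Thm. 5.1.1 (as proved) on the `−` line: torsion and a generator with non-zero constant term
  obtain ⟨htorsm, Fm, hFm, hFm0, -⟩ := h511 W p hp hord K hK hHp hHN ι v vbar hv hvbar hne κm hκm γm hEK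
    hrank hfin P₀ hP₀
  -- the value-carrying generator on the `−` line; it generates the same ideal, so it is non-zero too
  obtain ⟨F, hF, u, hu⟩ := hminus κm hκm γm
  obtain ⟨hF0, -⟩ := AcSelmer.valuation_constantCoeff_eq_of_span_singleton_eq (hFm.symm.trans hF) hFm0
  have hm : AcSelmer.XAc.HasCharValuationAt (W.baseChange K) p κm vbar ∅ γm
      (PowerSeries.constantCoeff F).valuation :=
    AcSelmer.XAc.hasCharValuationAt_of_eq htorsm hF hF0 rfl
  -- `v ∋ p` from the embedding
  have hvp : ((p : ℕ) : 𝓞 K) ∈ v.asIdeal := by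
    rw [hv]
    simp only [map_natCast]
    exact Padic.norm_p_lt_one
  -- [CGS25] Prop. 3.4.2 at `α = 𝟙`: transport the valuation to the `+` line
  obtain ⟨htors, Fp, hFp, hFp0, hval⟩ :=
    ((h342 W p hp hord K hK hHN hHp hEK hSel ⟨P₀, hP₀⟩ v vbar hvp hvbar hne κ κm hκ hκm γ γm).2.2
      _).mp hm
  -- two non-zero `p`-adic integers of equal valuation differ by a unit
  obtain ⟨w, hw⟩ : ∃ w : ℤ_[p]ˣ, PowerSeries.constantCoeff Fp = (w : ℤ_[p]) * PowerSeries.constantCoeff F := by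
    have hFp' := PadicInt.unitCoeff_spec hFp0
    have hF' := PadicInt.unitCoeff_spec hF0
    rw [hval] at hFp'
    refine ⟨PadicInt.unitCoeff hFp0 * (PadicInt.unitCoeff hF0)⁻¹, ?_⟩
    calc PowerSeries.constantCoeff Fp = _ := hFp'
      _ = ((PadicInt.unitCoeff hFp0 * (PadicInt.unitCoeff hF0)⁻¹ : ℤ_[p]ˣ) : ℤ_[p]) *
            ((PadicInt.unitCoeff hF0 : ℤ_[p]) * (p : ℤ_[p]) ^ (PowerSeries.constantCoeff F).valuation) := by
        rw [Units.val_mul, mul_assoc, Units.inv_mul_cancel_left]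
      _ = _ := by rw [← hF']
  refine ⟨htors, Fp, hFp, hFp0, w * u, ?_⟩
  rw [hw, PadicInt.coe_mul, hu, Units.val_mul, PadicInt.coe_mul]
  ring

end Summit.BirchSwinnertonDyer.BirchSwinnertonDyer.Theorems.InterludeWithTorsion

end
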